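import Mathlib
import HarnessLib
import HarnessLib.Audit
import Summits.HodgeConjecture.Statement
import Literature.AlgebraicGeometry.HodgeTheory.HodgeLocus
import HarnessLib.Audit.Status.Attr

/-!
Route: RigidUnwinding

DORMANT since 2026-08-26T16:57:31Z (reconciler: no traction for 5.5 d (last activity item-evidence-added at 2026-08-21T05:23:42Z); parked, not closed — `ledger route dormant route-HodgeConjecture-RigidUnwinding --off` to reactivate) — unstaffed, not closed; items shared with open routes are served there. `ledger route dormant <id> --off` reactivates.

# Route RigidUnwinding — Rigidity forces cycles — middle convolution reduces rigid comparison
classes to a Kummer/CM endgame (declared sector)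

DECLARED SECTOR ROUTE realising card katz-unwinding-rigid-comparison (the conforming successor of
the retired route KatzUnwinding,
re-typed over REAL carriers). It suffices to show X = RigidComparison: for every smooth projective
family f : 𝒴 → U over an open
U ⊂ P¹_ℂ, every pair of FLAT IDEMPOTENT ALGEBRAIC self-correspondences e on Hᵏ of the fibres and e'
on H^(k+2c), and every flat,
ℚ-rational family of operators Φ_t : Hᵏ(Y_t(ℂ);ℂ) → H^(k+2c)(Y_t(ℂ);ℂ) of Hodge bidegree (c,c)
carrying L := im e onto L' := im e',
IF L is an irreducible, cohomologically RIGID local system (Katz's numerical criterion Σ_p dim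
Z(T_p) = (|S|−2)·r² + 2, the local
centraliser dimensions rendered as dimensions of flat endomorphism families of L over small
connected neighbourhoods of the punctures),
THEN at every t the restriction Φ_t|L_t is induced by an algebraic class in N^(d+c)H^(2d+2c)(Y_t ×
Y_t) (pairing characterisation
pr₁*α ∪ ζ ∪ pr₂*β = pr₁*ω ∪ pr₂*(Ψα ∪ β); no Gysin/Künneth carriers needed). Two-family comparisons
X_t ~ K_t are the case 𝒴 = 𝒳 ×_U 𝒦
(L ⊗ H⁰, H⁰ ⊗ L'). X splits as KummerEndgame (same frame, 'rigid' replaced by 'finite monodromy':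
the CM bottom of Katz's algorithm) and
UnwindingReduction : KummerEndgame → X (Katz's algorithm read as algebraic correspondences on
interior cohomology), with
HypergeometricReduction (|S| = 3 + a pseudo-reflection: Levelt/Beukers–Heckman) as the first rung;
the frame to the summit is the
explicit NOT-claimed support SectorComplement : X → HodgeConjecture (as in DerivedTorelliFermat /
HeckePrymWeil / KugaSatakeSaturation).
Lean: `RigidComparison`

## Assembly
Pure logic (glue.lean, lean check rc 0, 0 sorries): `closes (h₂ : UnwindingReduction) (h₃ :
KummerEndgame) (hC : SectorComplement) :
_root_.HodgeConjecture := hC (h₂ h₃)` — the two cruxes compose to X = RigidComparison by modus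
ponens and the declared complement carries X
to the Statement. HypergeometricReduction / HypergeometricComparison are the first rung (a face of
X), not extra hypotheses of `closes`.

Rationale: WHY THIS LINE. Mechanism (Katz1996 Ch. 5–6 and 8; Haraoka2020 Thm 7.8, 7.14–7.15, 7.24; Simpson2009;
Dettweiler2008MC; DettweilerReiter2010): an
irreducible RIGID local system has no moduli and is reached from a rank-one Kummer sheaf by middle
convolutions MC_χ and rank-one twists,
each of which has a geometric avatar on families — and the new organising fact for provers is that
MC_χ(L)_t is EXACTLY the χ-part of the
INTERIOR cohomology Im(H^(n+1)_c → H^(n+1)) of the OPEN cyclic cover Y^(1)_t = {wᴺ = t − f} of the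
total space (Leray for the proper map
to the affine curve U∖{t}: H⁰_c and H² of a lisse sheaf vanish, and H⁰(U∖t, M ⊗ χ) = 0 because χ ≠ 1
at t), on which bi-proper
algebraic correspondences act with no parabolic projector; the only place where
Standard-Conjecture-B-type input could be needed is
Katz's inversion MC_χMC_χ̄(L) ≅ L(−1), carried by the explicit degenerate-fibre locus Y_t × (N lines
w₁ᴺ = −w₂ᴺ) — this is crux
UnwindingReduction, and it makes the route a REDUCTION-TO-CM theorem for rigid local systems
(RIGID-HC ⟸ KUMMER-HC), the analogue of
André's reduction of Hodge classes on abelian varieties to CM ones. The bottom (KummerEndgame: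
finite monodromy, Hodge types of CM
type) is where 'Hodge' is cashed: after base change to the trivialising Kummer curve it is HC for
one fixed-part class (DeligneHodgeII1971
4.1.1, CharlesSchnell2014Notes 11.3.4–5) on the tower's total space, closable today only when that
space is Fermat-dominated
(ShiodaKatsura1979, Shioda1979HodgeFermat, Aoki1987, Ran1980; Katz2009 for Delsarte/Dwork inputs)
and honestly open otherwise (it
contains Weil-type classes, Deligne1982HodgeCycles). Imported areas: rigid local systems / middle
convolution and their Hodge theory
(DettweilerSabbah2013), hypergeometric monodromy (BeukersHeckman1989), Fermat combinatorics, Hodge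
theory of families (Deligne1987 for
the uniqueness of the VHS that makes comparison classes Hodge). Versus the retired KatzUnwinding:
its three typed items quantified
∀ B : BettiHodgeData and were refuted-as-typed by the junk re-decorations B.pureEven / B.weil; here
every carrier is real
(complexBetti, FiberClass/IsContinuationAlong, IsRationalClass, IsOfHodgeType, algebraicClasses,
cupProduct), the Hodge hypothesis is
honest (rational + bidegree (c,c) on all of Hᵏ), the anti-collapse device is explicit (L, L' cut out
by algebraic idempotents: the
K × E_t collapse would need the projector onto α' ⊗ H¹(E_t) to be algebraic, which already forces α'
algebraic), and the deciding
theorem reaches `_root_.HodgeConjecture` through the declared complement. Versus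
Patrikis2016KugaSatakeI (middle convolution inside
André's motivated category, for Kuga–Satake LIFTING) and Andre1996Motifs: we need honest cycles for
a COMPARISON, so B must not be
load-bearing. Negatives index: empty at filing.

RANKED CRUXES. #0 RigidComparison (target) — X as in § Thesis — the rigid-comparison sector of the
Hodge conjecture on real carriers (one family 𝒴/U ⊂ P¹, degrees k and k+2c, flat algebraic
idempotents e, e', flat rational Hodge-(c,c) operator Φ with Φ(im e) = im e', im e irreducible and
numerically rigid ⇒ Φ|im e is induced by a class in N^(d+c)H^(2d+2c)(Y_t × Y_t) at every t). (why it
might fail: It is HC for flat anchor-free comparison classes of rigid constituents: a rigid pair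
with a provably non-algebraic comparison class refutes HC itself; outside Fermat-dominated towers no
engine closes the CM bottom.) [Katz1996, Haraoka2020, Deligne1987, DettweilerReiter2010, Yun2013,
CandelasDeLaOssaRodriguezVillegas2003, Katz2009]
#2 KummerEndgame (crux) — the finite-monodromy bottom (card U2/U3 as ONE statement): same frame as
the target with 'numerically rigid' replaced by FINITE MONODROMY of L = im e (every class of L_s has
finitely many flat continuations along loops); conclusion identical. Informally: a flat rational
Hodge comparison between two geometric realisations of a Galois orbit of Kummer characters is
induced by algebraic cycles; after base change to the trivialising Fermat/Kummer curve it is HC for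
ONE fixed-part class on a smooth completion of the total space (DeligneHodgeII1971 4.1.1,
CharlesSchnell2014Notes 11.3.4–5), closed by Shioda–Katsura–Aoki when that space is Fermat-dominated
(Delsarte towers: each cover / base change adjoins one variable and one binomial relation) and open
otherwise. [difficulty: open-problem] (why it might fail: Contains Weil/CM-type classes (constant CM
abelian family × Kummer torsor, e = CM spectral idempotent: Deligne1982HodgeCycles) — open; sole
engine is Fermat domination, and Shioda's condition fails at composite degrees (Aoki sectors).)
[Shioda1979HodgeFermat, ShiodaKatsura1979, Aoki1987, Ran1980, DeligneHodgeII1971,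
CharlesSchnell2014Notes, Deligne1982HodgeCycles, Katz2009, Chatzistamatiou2009]
#3 UnwindingReduction (crux) — KummerEndgame → RigidComparison: Katz's algorithm (Haraoka2020 Thm
7.24 / Katz1996 5.2.1: irreducible rigid ⇒ a word of middle convolutions MC_χ and rank-one twists
applied to a rank-one Kummer system) run BACKWARDS on the family: each MC_χ̄ is the χ̄-part of the
interior cohomology of the open cyclic cover of the total space (bi-proper cover graph ∘ character
projector = algebraic correspondence; irreducibility, index of rigidity, algebraic cut-out and Hodge
bidegree are inherited: Haraoka2020 Thm 7.14–7.15, DettweilerSabbah2013 Thm 1), the rank drops to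
one with finite monodromy (an instance of KummerEndgame), and the comparison is wound back through
Katz's inversion MC_χMC_χ̄ ≅ id(−1) realised by the degenerate-fibre locus Y_t × (N lines), plus the
algebraic-inverse trick for multiplicity-one middle-degree constituents (card U1 + U5). [deps:
KummerEndgame] [difficulty: XL] (why it might fail: Katz inversion must be induced on INTERIOR
cohomology by the locus Y_t×(N lines); boundary classes live in the same isotypic part (h¹_c − h¹_!
= Σ coinvariants ≠ 0), so that class may fail to be interior and need a B-type projector to
correct.) [Katz1996, Haraoka2020, Dettweiler2008MC, DettweilerSabbah2013, DettweilerReiter2010,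
Simpson2009, Patrikis2016KugaSatakeI, Andre1996Motifs, DoranKostiuk2019]
#4 HypergeometricComparison (crux) — the hypergeometric face of the target (typed): same frame,
hypothesis 'exactly three punctures and at one of them the local flat sections of L have codimension
one (pseudo-reflection)'; conclusion identical. By Levelt / BeukersHeckman1989 Thm 3.5 such L are
sums of conjugate hypergeometrics H(α;β), hence rigid, so this is the |S| = 3 face of
RigidComparison; it is the conclusion of HypergeometricReduction and the statement whose instances
(Dwork pencils vs Katz curve families; symmetric K3 quartic pencils) the first provers will actually
close — directly or through the reduction. [difficulty: XL] (why it might fail: HC for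
hypergeometric comparison classes: outside Delsarte inputs (where Shioda maps / coniveau already
give the cycles) no instance is closed; one hypergeometric pair with a non-algebraic comparison
class refutes HC.) [BeukersHeckman1989, Katz1996, Katz2009, CandelasDeLaOssaRodriguezVillegas2003,
Chatzistamatiou2009, BiniVangeemenKelly2011]
#5 HypergeometricReduction (crux) — KummerEndgame → HypergeometricComparison: the first rung of
UnwindingReduction, for |S| = 3 and a pseudo-reflection at one puncture (Levelt / BeukersHeckman1989
Thm 3.5: L ⊗ ℂ is a sum of hypergeometrics H(α;β), each reached from rank one by r − 1 middle
convolutions by Kummer sheaves, ranks 1,2,…,r; the tower is the classical Euler-integral tower yᴺ =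
∏ xᵢ^aᵢ (1 − xᵢ)^bᵢ (t − x₁⋯x_m)^c, Katz2009 §5). Flagship calibration: the rank-4 piece of H³ of
the Dwork quintics versus Katz's / CdlORV's curve realisations (known abstractly by coniveau,
Chatzistamatiou2009 — a test of the METHOD, not a new theorem), then the symmetric K3 quartic
pencils. [deps: KummerEndgame] [difficulty: L] (why it might fail: Same inversion-as-cycle issue as
UnwindingReduction, already for the Legendre family (double plane branched along two conics): if the
signed sum of the 4 lines over s = t is not orthogonal to the isotypic boundary curves, the cycle
form is dead.) [BeukersHeckman1989, Katz1996, Katz2009, CandelasDeLaOssaRodriguezVillegas2003,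
Chatzistamatiou2009, DoranKostiuk2019]
#9 SectorComplement (support) — (bookkeeping, NOT claimed) the complement of the route's sector:
RigidComparison → HodgeConjecture. It exists so that the deciding theorem concludes the sub-problem
Statement by name (declared sector route, D-0027 §2.1, same device as
DerivedTorelliFermat.FourfoldSectorComplement / HeckePrymWeil.SummitOffWeilSector); nobody is asked
to prove it and graders should judge the route on UnwindingReduction / KummerEndgame /
HypergeometricReduction. Any route proving the summit outright supersedes it. [difficulty:
open-problem] [Deligne2000]

TWO-LAYER PLAN. Foreseen glued splits (nothing filed now). UnwindingReduction ⇐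
ConvolutionFunctoriality (MC_χ of a relative bi-proper algebraic
correspondence between two tower objects is a relative bi-proper algebraic correspondence between
their cyclic-cover objects, acting
compatibly on interior cohomology — formal) → InversionCycles (Katz's inversion isomorphism and its
inverse are induced on interior
cohomology by the degenerate-fibre locus; THE crux inside the crux; decidable first on the Legendre
tower where everything is divisors on
rational/elliptic surfaces) → UnwindingReduction (bookkeeping: Katz's algorithm Haraoka2020 Thm
7.24, inheritance of irreducibility /
rigidity index / cut-out / Hodge bidegree DettweilerSabbah2013, algebraic inverse of an algebraic
iso between multiplicity-one
middle-degree constituents by the transpose + Cayley–Hamilton trick, two-family ↦ one-family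
embedding). KummerEndgame ⇐
DelsarteTowerEndgame (inputs = invertible / generalized-Dwork pencils and Katz curve families: every
level of the tower, base-changed to
the trivialising Kummer curve, is a Delsarte complete intersection dominated by a product of Fermat
varieties; Shioda's condition in the
relevant degrees) → DominantDescent (HC descends along dominant rational maps: pull back, prove,
push forward / deg) → KummerEndgame
restricted to Fermat-dominated towers; the non-Delsarte remainder (symmetric K3 quartic pencils:
known abstractly by Mukai–Buskin–Huybrechts;
Yun's G₂ family vs Dettweiler–Reiter's: open) stays a named open face.

KILL CRITERIA. (a) An honest instance (two realisations, computed local monodromies and Hodge types)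
whose comparison class is NON-algebraic refutes
RigidComparison or KummerEndgame and thereby HC: close refuted:<Decl>, escalate (summit news). (b)
The route dies AS A MECHANISM if the
Legendre inversion test (Cheapest falsifier) shows the degenerate-fibre class is not interior in its
isotypic component and no divisor
correction exists without a B-type projector: then UnwindingReduction is only a motivated-cycle
statement (= Patrikis2016KugaSatakeI +
Andre1996Motifs, known) — close exhausted with that census or re-open as a conditional bridge on B
for the cover varieties. (c) If the
census finds every rigid pair in print already related by a dominant rational map (Shioda maps:
BiniVangeemenKelly2011, Kelly2013,
Kloosterman2017) AND Yun2013's G₂ family is identified geometrically with Dettweiler–Reiter's, X has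
no open instance of independent
interest: downgrade to 'explicit-cycle engine' (support of other routes) or close superseded by
AnchorTransport. (d) A proof of
AnchorTransport.VariationalHodge plus algebraic anchors for all Katz towers moots
UnwindingReduction's cycle form.

NOT DECOMPOSED YET. Deliberately not filed at open: the split children above
(ConvolutionFunctoriality, InversionCycles need MC_χ and interior cohomology
H_!(Y) = Im(H_c → H) of an open variety as Lean notions — definition requests below);
DelsarteTowerEndgame as a TYPED statement (needs
Delsarte-complete-intersection vocabulary and the Shioda–Katsura domination fact); the
Yun–Dettweiler–Reiter G₂ flagship instance (card U4,
the live territory per the card's 5th/6th audits: level ≥ 3 rigid, realised twice, no Shioda map);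
the negative branch (exact cyclotomic
periods of the endgame class vs Aoki cycles); the c < 0 direction (covered by applying X to Φ⁻¹ and
the algebraic-inverse lemma); the
summit-side calibration HC ⇒ X (Künneth/PD of a rational (c,c) operator class). Typing caveat for
grounders: `Alg`, `Flat`, the local
flat-endomorphism / flat-section families and the puncture set are `let`-bound inside each statement
(no new tree definitions); a later
`set-signature` may replace them by Literature notions once filed.

CHEAPEST FALSIFIER. The Legendre inversion test (curves and rational/elliptic surfaces only;
Lefschetz (1,1) decides): L = Kummer sheaf of
x^(−1/2)(x−1)^(−1/2) in H⁰ of C : v² = s(s−1) over P¹∖{0,1,∞}; Y^(1)_t = {v² = s(s−1), w² = t − s} ≅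
Legendre E_t (MC_sign(L) = H¹(E_t),
rigid: 2+2+2 = 6 = 4+2); Y^(2)_t = {v² = s(s−1), w₁² + w₂² = t − s} = double plane branched along
two conics, and MC_sign MC_sign(L)_t =
L_t(−1) has rank 1 in H²_!(Y^(2)_t)^(−,−,−) (χ(P¹, j_*(H¹(E) ⊗ sign)) = −4 + 3). CHECK: the signed
sum D = ℓ₊₊ − ℓ₊₋ − ℓ₋₊ + ℓ₋₋ of the
four lines over s = t (i) spans that piece, (ii) meets every boundary curve class of the same
isotypic component trivially (D ∈ B^⊥ — a
finite intersection computation on an explicit rational surface), (iii) winding id_L down and up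
returns a divisor on E_s × E_s acting as
the identity on H¹. (ii) failing with no divisor correction = Kill (b). Run here at design time:
rigidity numerics of the typed RigidHyp
(Legendre 6 = 4+2; Dwork-quintic H³ 4+10+4 = 18 = 16+2), the K×E_t / E-coefficient collapse checks
of the frame, Sketch.lean rc 0.

NUMBERS. |S| = 3 for hypergeometrics (pseudo-reflection at one puncture, BeukersHeckman1989 Thm
3.5); index of rigidity ι = (2−|S|)r² + Σ dim Z(T_p),
irreducible ⇒ ι ≤ 2, rigid ⇔ ι = 2 (Haraoka2020 Def. 7.4 / Thm 7.8 = Katz1996 1.1.2). Dwork quintic: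
b₃ = 204 = 4 (hypergeometric
H(1/5,2/5,3/5,4/5;0,0,0,0): MUM at λ = 0, conifold at λ = 1, order 5 at ∞) + 200 (curve pieces A, B:
CandelasDeLaOssaRodriguezVillegas2003
§§9–11; coniveau one by Chatzistamatiou2009); unwinding depth r − 1 = 3, all covers of degree 5
(prime ⇒ Shioda's regime if the tower stays
Delsarte). Shioda: HC for Fermat Xⁿ_m, all n, when m is prime or m ≤ 20 (Shioda1979HodgeFermat Thm
IV; Aoki1987 for the first composite
failures of condition (P)). Items at open: 7 (target, 4 cruxes, 1 support, assembly).

DEFINITION REQUESTS. (1) `Literature.…LocalSystem.middleConvolution` — Katz's MC_χ on local systems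
of K-vector spaces on ℂ minus a finite set with its basic
named facts (MC_χ̄MC_χ ≅ id(−1) on objects with property P, rank / local-monodromy formulae
Haraoka2020 Thm 7.19, preservation of
irreducibility and of the index of rigidity Thm 7.14–7.15, existence algorithm Thm 7.24 = Katz1996
5.2.1) — topic
Literature/AlgebraicGeometry/Motives; for the split children of UnwindingReduction. (2) compactly
supported singular cohomology of
ComplexPoints and INTERIOR cohomology H_!(Y) := Im(H_c → H) with the action of bi-proper
correspondences — topic
Literature/AlgebraicTopology/SingularHomology; for ConvolutionFunctoriality / InversionCycles. (3)
`IsDelsarteCompleteIntersection` +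
the Shioda–Katsura domination fact (ShiodaKatsura1979; Shioda maps BiniVangeemenKelly2011) — topic
Literature/AlgebraicGeometry/Motives; for
DelsarteTowerEndgame. (4) Cite facts wanted (family hodge): Katz1996 Thm 1.1.2 and Thm 8.4.1;
BeukersHeckman1989 Thm 3.5; Deligne1987 Prop 1.13
(uniqueness of a polarizable ℂ-VHS on an irreducible local system up to shift); DettweilerSabbah2013
Thm 1; Yun2013 (G₂-local systems on
P¹∖{0,1,∞} and their expected coincidence with Dettweiler–Reiter's by rigidity).

Novelty: Searches (2026-08-15, this session; the card's six refuter audits re-read): `lit search --hybrid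
"middle convolution rigid local system
algebraic cycles Hodge conjecture"` (12 held books: Haraoka2020 — read PDF pp. 137, 153–164: Def
7.4, Thm 7.8, 7.14–7.15, 7.22–7.24 —,
Kerr–Pearlstein 2016, Katz 1988/1990, Voisin I/II, Cattani et al. 2014; nothing on cycles for
comparisons); `lit search --source zbmath
"middle convolution Hodge"` (15: DettweilerSabbah2013, Simpson2009, Dettweiler–Reiter 2020
arXiv:1809.06080, Martin 2021 arXiv:1808.08715,
DoranKostiuk2019 arXiv:1911.00402 — geometric variations of local systems realised on elliptic
surfaces, the closest geometric MC
calculus, no cycles/HC —, Patrikis arXiv:1407.1942, Lam–Landesman–Litt arXiv:2308.01376); `lit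
search --source crossref` for Yun2013
(doi:10.1007/s00222-013-0469-9) and Chatzistamatiou2009 (doi:10.4310/mrl.2009.v16.n4.a2); `lit
galaxy search "middle convolution" --star
all` (21 rows: Geißler 2017 thesis 'Enhanced middle convolution', rest noise) and `"rigid local
systems" --star all` (Esnault LNM 2337,
Dettweiler–Wewers math/0411119 on parabolic cohomology, Chen–Yi arXiv:2407.20593 on Yun's rigid
automorphic data); `lit frontier
HodgeConjecture --since 2020` (30; arXiv:2603.22171 exceptional loci of motivic local systems —
orthogonal: our classes have Hodge locus
= U); `lit bridges HodgeConjecture --cross any` (nothing on rigid local systems); OpenAlex returned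
HTTP 429 (logged); grep of Theses/ for
'middle convo  [refs: 10.1007/s00222-013-0469-9, 10.4310/mrl.2009.v16.n4.a2, 1809.06080, 1808.08715, 1911.00402, 1407.1942, 2308.01376, 2407.20593, 2603.22171, doi:10.1007/s00222-013-0469-9, doi:10.4310/mrl.2009.v16.n4.a2, Haraoka2020, DettweilerSabbah2013, Simpson2009, DoranKostiuk2019, Yun2013, Chatzistamatiou2009, Katz1996, Katz2009, DettweilerReiter2010, BiniVangeemenKelly2011, Kelly2013, Kloosterman2017]

Barriers (technique_class: middle-convolution, rigid-local-systems, fermat-varieties): - technique_class: middle-convolution, rigid-local-systems, fermat-varieties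
- Literature.Barriers.HodgeConjecture.Andre1996_hodgeClassesOnAbelianVarieties_motivated:
André/Patrikis use of families yields MOTIVATED classes and stops at Standard Conjecture B; here
each MC step is an honest bi-proper correspondence on interior cohomology and needs no projector; B
could re-enter only at Katz's inversion (is the degenerate-fibre class interior?) — not evaded yet
but localised into ONE why-might-fail (UnwindingReduction) with a decidable Legendre test; the
Delsarte endgame evades B outright (Shioda's cycles are explicit).
- Literature.Barriers.HodgeConjecture.Weil1977_exceptionalHodgeClasses: NOT evaded — KummerEndgame
contains Weil/CM-type comparison classes (constant CM abelian family × Kummer torsor); declared as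
its why-might-fail; the route claims closure only on Fermat-dominated towers.
- Literature.Barriers.HodgeConjecture.Mumford1968_simpleFourfold_exceptionalHodgeClasses: same
sector as Weil1977; same answer.
- Literature.Barriers.HodgeConjecture.CattaniDeligneKaplan1995_hodgeLocus_algebraicFor: consistent
and irrelevant — the comparison classes are flat and Hodge on all of U (Hodge locus = U by
Deligne1987 / CharlesSchnell2014Notes 11.3.5), no locus geometry is used.
- Literature.Barriers.HodgeConjecture.Voisin2003_generalHypersurface_noIntegralClassInF: not touched
— the base curve carries local systems, never intermediate Jacobians; no normal function is
inverted.
- Li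

History (route lifecycle, newest last):
- 2026-08-15T20:19:51Z · rev 3: restated HypergeometricReduction (stmt-HodgeConjecture-14769) — repair, NO change of meaning (parenthesised spelling of the same term): stmt-14769 HypergeometricReduction was flagged blocked_missing_decls=[HypergeometricComp (planner-retriage-HodgeConjecture-RigidUnwinding-0)
- 2026-08-15T21:20:55Z · rev 7: restated Assembly (stmt-HodgeConjecture-14771) — route-repair (ground-failed): Assembly (stmt-HodgeConjecture-14771) was flagged ground.trivial (tauto) because it was closes re-curried = pure logic over the gl (planner-rground-HodgeConjecture-RigidUnwinding-e4855793-0)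
- 2026-08-16T02:19:16Z · AUTO-CRUX: 1 conjecture-grade item(s) promoted to crux (AlgebraicInverse) — refuter vetting / tiering apply (operator:999:1362873)
- 2026-08-26T16:57:31Z · DORMANT — reconciler: no traction for 5.5 d (last activity item-evidence-added at 2026-08-21T05:23:42Z); parked, not closed — `ledger route dormant route-HodgeConjecture- (operator:999:3185604)

sub-problem: HodgeConjecture · status: dormant · opened planner-plancard-HodgeConjecture-HodgeConject-6ed9cb67-g2-0 2026-08-15T19:12:01Z · rev 7 · ledger route-HodgeConjecture-RigidUnwinding
GENERATED by the gate from the ledger (D-0016/17). Provers cite these decls: `theorem foo : Summit.HodgeConjecture.HodgeConjecture.Theses.RigidUnwinding.<Decl> := …` in Summits/HodgeConjecture/HodgeConjecture/Theorems/<Name>.lean.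
-/

namespace Summit.HodgeConjecture.HodgeConjecture.Theses.RigidUnwinding

open scoped BigOperators Topology Manifold Classical MeasureTheory ProbabilityTheory Matrix InnerProductSpace ComplexConjugate ContinuousMap
open Filter Set Function TopologicalSpace MeasureTheory

attribute [summit_statement] _root_.HodgeConjecture

/-- item stmt-HodgeConjecture-14765 · target · rank 0 · open · by planner
why it might fail: HC-sector whose r=1 corner (rank-1 L passes Katz's count for free, finite monodromy) already asserts algebraicity of the Hodge–Weil classes of EVERY Weil-type abelian 2n-fold (constant A×E_K family, L=σ-eigenline of H¹(E_K), Φ=w⊗_K·): open for 2n≥6 beyond Markman's disc −1 sixfolds. ¬X would be ¬HC.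
sources: Katz1996, Haraoka2020, Deligne1987, Weil1977HodgeRing, MoonenZarhin1999, Schoen1988HodgeWeil
[target] X as in § Thesis — the rigid-comparison sector of the Hodge conjecture on real carriers
(one family 𝒴/U ⊂ P¹, degrees k and k+2c, flat algebraic idempotents e, e', flat rational
Hodge-(c,c) operator Φ with Φ(im e) = im e', im e irreducible and numerically rigid ⇒ Φ|im e is
induced by a class in N^(d+c)H^(2d+2c)(Y_t × Y_t) at every t). -/
@[route_item "route-HodgeConjecture-RigidUnwinding"]
def RigidComparison : Prop :=
  open CategoryTheory MonoidalCategory CartesianMonoidalCategory Literature.AlgebraicGeometry.Motives Literature.AlgebraicGeometry.HodgeTheory Literature.AlgebraicTopology.SingularHomology in ∀ (U 𝒴 : SchemeOver ℂ) (j : U ⟶ projectiveSpace 1 ℂ) (f : 𝒴 ⟶ U) (d k c : ℕ) (e : ∀ t : ComplexPoints U, complexBetti (fiberOver f t) k →ₗ[ℂ] complexBetti (fiberOver f t) k) (e' : ∀ t : ComplexPoints U, complexBetti (fiberOver f t) (k + 2 * c) →ₗ[ℂ] complexBetti (fiberOver f t) (k + 2 * c)) (Φ : ∀ t : ComplexPoints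 U, complexBetti (fiberOver f t) k →ₗ[ℂ] complexBetti (fiberOver f t) (k + 2 * c)), let Alg := fun (a q b : ℕ) (t : ComplexPoints U) (T : complexBetti (fiberOver f t) a →ₗ[ℂ] complexBetti (fiberOver f t) b) => ∃ ζ ∈ algebraicClasses (fiberOver f t ⊗ fiberOver f t) q, ∃ ω : complexBetti (fiberOver f t) (2 * d), ω ≠ 0 ∧ ∀ (b' : ℕ) (hb : b + b' = 2 * d) (hq : (a + 2 * q) + b' = 4 * d) (α : complexBetti (fiberOver f t) a) (β : complexBetti (fiberOver f t) b'), cupProduct hq (cupProduct (show a + 2 * q = a + 2 * q from rfl) (complexBetti.map (fst (fiberOver f t) (fiberOver f t)) a α) ζ) (complexBetti.map (snd (fiberOver f t) (fiberOver f t)) b' β) = cupProduct (show 2 * d + 2 * d = 4 * d by omega) (complexBetti.map (fst (fiberOver f t) (fiberOver f t)) (2 * d) ω) (complexBetti.map (snd (fiberOver f t) (fiberOver f t)) (2 * d) (cupProduct hb (T α) β)); let Flat := fun (a b : ℕ) (T : ∀ t : ComplexPoints U, complexBetti (fiberOver f t) a →ₗ[ℂ] complexBetti (fiberOver f t) b)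 => ∀ (s t : ComplexPoints U) (γ : Path s t) (α : complexBetti (fiberOver f s) a) (β : complexBetti (fiberOver f t) a), IsContinuationAlong γ α β → IsContinuationAlong γ (T s α) (T t β); AlgebraicGeometry.IsOpenImmersion j.left → Nonempty (ComplexPoints U) → IsSmoothProjectiveFamily f d → (∀ t, e t ∘ₗ e t = e t ∧ Alg k d k t (e t)) → Flat k k e → (∀ t, e' t ∘ₗ e' t = e' t ∧ Alg (k + 2 * c) d (k + 2 * c) t (e' t)) → Flat (k + 2 * c) (k + 2 * c) e' → Flat k (k + 2 * c) Φ → (∀ t x, IsRationalClass x → IsRationalClass (Φ t x)) → (∀ t (p q : ℕ), p + q = k → ∀ x, IsOfHodgeType d (fiberOver f t) k p q x → IsOfHodgeType d (fiberOver f t) (k + 2 * c) (p + c) (q + c) (Φ t x)) → (∀ t, Submodule.map (Φ t) (LinearMap.range (e t)) = LinearMap.range (e' t)) → (∀ M : (∀ t : ComplexPoints U, Submodule ℂ (complexBetti (fiberOver f t) k)), (∀ t, M t ≤ LinearMap.range (e t)) → (∀ (s t : ComplexPoints U) (γ : Path s t) (α : complexBetti (fiberOver f s) k) (β : complexBetti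 (fiberOver f t) k), α ∈ M s → IsContinuationAlong γ α β → β ∈ M t) → (∀ t, M t = ⊥) ∨ (∀ t, M t = LinearMap.range (e t))) → (∃ dloc : {p : ComplexPoints (projectiveSpace 1 ℂ) // p ∉ Set.range (AlgPoints.map j)} → ℕ, (∀ p : {p : ComplexPoints (projectiveSpace 1 ℂ) // p ∉ Set.range (AlgPoints.map j)}, ∃ O₀ ∈ nhds p.1, ∀ O ∈ nhds p.1, O ⊆ O₀ → IsOpen O → IsConnected O → Module.finrank ℂ (Submodule.span ℂ {ψ : ∀ t : ComplexPoints U, complexBetti (fiberOver f t) k →ₗ[ℂ] complexBetti (fiberOver f t) k | (∀ t, ψ t ∘ₗ e t = ψ t ∧ e t ∘ₗ ψ t = ψ t) ∧ (∀ t, AlgPoints.map j t ∉ O → ψ t = 0) ∧ ∀ (s t : ComplexPoints U) (γ : Path s t), (∀ x, AlgPoints.map j (γ x) ∈ O) → ∀ (α : complexBetti (fiberOver f s) k) (β : complexBetti (fiberOver f t) k), IsContinuationAlong γ α β → IsContinuationAlong γ (ψ s α) (ψ t β)}) = dloc p) ∧ ∀ t, (∑ᶠ p, (dloc p : ℤ))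 = ((Nat.card {p : ComplexPoints (projectiveSpace 1 ℂ) // p ∉ Set.range (AlgPoints.map j)} : ℤ) - 2) * (Module.finrank ℂ (LinearMap.range (e t)) : ℤ) ^ 2 + 2) → ∀ t, ∃ Ψ : complexBetti (fiberOver f t) k →ₗ[ℂ] complexBetti (fiberOver f t) (k + 2 * c), Alg k (d + c) (k + 2 * c) t Ψ ∧ Ψ ∘ₗ e t = Φ t ∘ₗ e t

/-- item stmt-HodgeConjecture-14766 · crux · rank 2 · open · by planner
why it might fail: Finite-monodromy bottom = HC for one fixed-part class on the base-changed total space: contains (i) Hodge–Weil classes of ALL Weil-type abelian 2n-folds (constant family), open for 2n≥6 beyond disc −1, (ii) Fermat Xⁿ_m eigenclasses outside Shioda's (P) (composite m>20); sole engine Fermat domination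
sources: Weil1977HodgeRing, Deligne1982HodgeCycles, MoonenZarhin1999, Schoen1988HodgeWeil, Markman2025SecantWeil, Shioda1979HodgeFermat
[crux] the finite-monodromy bottom (card U2/U3 as ONE statement): same frame as the target with
'numerically rigid' replaced by FINITE MONODROMY of L = im e (every class of L_s has finitely many
flat continuations along loops); conclusion identical. Informally: a flat rational Hodge comparison
between two geometric realisations of a Galois orbit of Kummer characters is induced by algebraic
cycles; after base change to the trivialising Fermat/Kummer curve it is HC for ONE fixed-part class
on a smooth completion of the total space (DeligneHodgeII1971 4.1.1, CharlesSchnell2014Notes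
11.3.4–5), closed by Shioda–Katsura–Aoki when that space is Fermat-dominated (Delsarte towers: each
cover / base change adjoins one variable and one binomial relation) and open otherwise. [difficulty:
open-problem] -/
@[route_item "route-HodgeConjecture-RigidUnwinding", crux]
def KummerEndgame : Prop :=
  open CategoryTheory MonoidalCategory CartesianMonoidalCategory Literature.AlgebraicGeometry.Motives Literature.AlgebraicGeometry.HodgeTheory Literature.AlgebraicTopology.SingularHomology in ∀ (U 𝒴 : SchemeOver ℂ) (j : U ⟶ projectiveSpace 1 ℂ) (f : 𝒴 ⟶ U) (d k c : ℕ) (e : ∀ t : ComplexPoints U, complexBetti (fiberOver f t) k →ₗ[ℂ] complexBetti (fiberOver f t) k) (e' : ∀ t : ComplexPoints U, complexBetti (fiberOver f t) (k + 2 * c) →ₗ[ℂ] complexBetti (fiberOver f t) (k + 2 * c)) (Φ : ∀ t : ComplexPoints U, complexBetti (fiberOver f t) k →ₗ[ℂ] complexBetti (fiberOver f t) (k + 2 * c)), let Alg := fun (a q b : ℕ) (t : ComplexPoints U) (T : complexBetti (fiberOver f t) a →ₗ[ℂ] complexBetti (fiberOver f t) b) => ∃ ζ ∈ algebraicClasses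 (fiberOver f t ⊗ fiberOver f t) q, ∃ ω : complexBetti (fiberOver f t) (2 * d), ω ≠ 0 ∧ ∀ (b' : ℕ) (hb : b + b' = 2 * d) (hq : (a + 2 * q) + b' = 4 * d) (α : complexBetti (fiberOver f t) a) (β : complexBetti (fiberOver f t) b'), cupProduct hq (cupProduct (show a + 2 * q = a + 2 * q from rfl) (complexBetti.map (fst (fiberOver f t) (fiberOver f t)) a α) ζ) (complexBetti.map (snd (fiberOver f t) (fiberOver f t)) b' β) = cupProduct (show 2 * d + 2 * d = 4 * d by omega) (complexBetti.map (fst (fiberOver f t) (fiberOver f t)) (2 * d) ω) (complexBetti.map (snd (fiberOver f t) (fiberOver f t)) (2 * d) (cupProduct hb (T α) β)); let Flat := fun (a b : ℕ) (T : ∀ t : ComplexPoints U, complexBetti (fiberOver f t) a →ₗ[ℂ] complexBetti (fiberOver f t) b) => ∀ (s t : ComplexPoints U) (γ : Path s t) (α : complexBetti (fiberOver f s) a) (β : complexBetti (fiberOver f t) a), IsContinuationAlong γ α β → IsContinuationAlong γ (T s α) (T t β); AlgebraicGeometry.IsOpenImmersion j.left → Nonempty (ComplexPoints U) → IsSmoothProjectiveFamily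 f d → (∀ t, e t ∘ₗ e t = e t ∧ Alg k d k t (e t)) → Flat k k e → (∀ t, e' t ∘ₗ e' t = e' t ∧ Alg (k + 2 * c) d (k + 2 * c) t (e' t)) → Flat (k + 2 * c) (k + 2 * c) e' → Flat k (k + 2 * c) Φ → (∀ t x, IsRationalClass x → IsRationalClass (Φ t x)) → (∀ t (p q : ℕ), p + q = k → ∀ x, IsOfHodgeType d (fiberOver f t) k p q x → IsOfHodgeType d (fiberOver f t) (k + 2 * c) (p + c) (q + c) (Φ t x)) → (∀ t, Submodule.map (Φ t) (LinearMap.range (e t)) = LinearMap.range (e' t)) → (∀ M : (∀ t : ComplexPoints U, Submodule ℂ (complexBetti (fiberOver f t) k)), (∀ t, M t ≤ LinearMap.range (e t)) → (∀ (s t : ComplexPoints U) (γ : Path s t) (α : complexBetti (fiberOver f s) k) (β : complexBetti (fiberOver f t) k), α ∈ M s → IsContinuationAlong γ α β → β ∈ M t) → (∀ t, M t = ⊥) ∨ (∀ t, M t = LinearMap.range (e t))) → (∀ (s : ComplexPoints U) (α : complexBetti (fiberOver f s) k), α ∈ LinearMap.range (e s) → Set.Finite {β : complexBetti (fiberOver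 f s) k | ∃ γ : Path s s, IsContinuationAlong γ α β}) → ∀ t, ∃ Ψ : complexBetti (fiberOver f t) k →ₗ[ℂ] complexBetti (fiberOver f t) (k + 2 * c), Alg k (d + c) (k + 2 * c) t Ψ ∧ Ψ ∘ₗ e t = Φ t ∘ₗ e t

/-- item stmt-HodgeConjecture-14767 · crux · rank 3 · open · by planner
why it might fail: Each MC step must stay in the frame: MC_χ̄(L) ⊂ H^(k+1) of a smooth-projective COMPACTIFIED cover family as image of a FLAT ALGEBRAIC idempotent (middle = naive minus boundary pieces, same isotypic part), and Katz inversion induced on H_! by the degenerate-fibre cylinder cycle; either may need B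
sources: Katz1996, Haraoka2020, Dettweiler2008MC, DettweilerSabbah2013, DettweilerReiter2010, Andre1996Motifs
[crux] KummerEndgame → RigidComparison: Katz's algorithm (Haraoka2020 Thm 7.24 / Katz1996 5.2.1:
irreducible rigid ⇒ a word of middle convolutions MC_χ and rank-one twists applied to a rank-one
Kummer system) run BACKWARDS on the family: each MC_χ̄ is the χ̄-part of the interior cohomology of
the open cyclic cover of the total space (bi-proper cover graph ∘ character projector = algebraic
correspondence; irreducibility, index of rigidity, algebraic cut-out and Hodge bidegree are
inherited: Haraoka2020 Thm 7.14–7.15, DettweilerSabbah2013 Thm 1), the rank drops to one with finite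
monodromy (an instance of KummerEndgame), and the comparison is wound back through Katz's inversion
MC_χMC_χ̄ ≅ id(−1) realised by the degenerate-fibre locus Y_t × (N lines), plus the
algebraic-inverse trick for multiplicity-one middle-degree constituents (card U1 + U5). [deps:
KummerEndgame] [difficulty: XL] -/
@[route_item "route-HodgeConjecture-RigidUnwinding", crux]
def UnwindingReduction : Prop :=
  KummerEndgame → RigidComparison

/-- item stmt-HodgeConjecture-14768 · crux · rank 4 · open · by planner
why it might fail: |S|=3 face of #0, NO endgame hypothesis: r=1 corner (A×E_K×isotrivial Kummer curve, pseudo-reflection at 0, finite monodromy) = Hodge–Weil classes of every Weil-type abelian 2n-fold, open for 2n≥6; for r≥2 non-Delsarte hypergeometric pairs (toric arXiv:2602.14204 vs Katz towers) have no known cycle.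
sources: BeukersHeckman1989, Katz1996, Katz2009, Weil1977HodgeRing, Markman2025SecantWeil, 2602.14204
[crux] the hypergeometric face of the target (typed): same frame, hypothesis 'exactly three
punctures and at one of them the local flat sections of L have codimension one (pseudo-reflection)';
conclusion identical. By Levelt / BeukersHeckman1989 Thm 3.5 such L are sums of conjugate
hypergeometrics H(α;β), hence rigid, so this is the |S| = 3 face of RigidComparison; it is the
conclusion of HypergeometricReduction and the statement whose instances (Dwork pencils vs Katz curve
families; symmetric K3 quartic pencils) the first provers will actually close — directly or through
the reduction. [difficulty: XL] -/
@[route_item "route-HodgeConjecture-RigidUnwinding"]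
def HypergeometricComparison : Prop :=
  open CategoryTheory MonoidalCategory CartesianMonoidalCategory Literature.AlgebraicGeometry.Motives Literature.AlgebraicGeometry.HodgeTheory Literature.AlgebraicTopology.SingularHomology in ∀ (U 𝒴 : SchemeOver ℂ) (j : U ⟶ projectiveSpace 1 ℂ) (f : 𝒴 ⟶ U) (d k c : ℕ) (e : ∀ t : ComplexPoints U, complexBetti (fiberOver f t) k →ₗ[ℂ] complexBetti (fiberOver f t) k) (e' : ∀ t : ComplexPoints U, complexBetti (fiberOver f t) (k + 2 * c) →ₗ[ℂ] complexBetti (fiberOver f t) (k + 2 * c)) (Φ : ∀ t : ComplexPoints U, complexBetti (fiberOver f t) k →ₗ[ℂ] complexBetti (fiberOver f t) (k + 2 * c)), let Alg := fun (a q b : ℕ) (t : ComplexPoints U) (T : complexBetti (fiberOver f t) a →ₗ[ℂ] complexBetti (fiberOver f t) b) => ∃ ζ ∈ algebraicClasses (fiberOver f t ⊗ fiberOver f t) q, ∃ ω : complexBetti (fiberOver f t) (2 * d), ω ≠ 0 ∧ ∀ (b' : ℕ) (hb : b + b' = 2 * d) (hq : (a + 2 * q) + b' = 4 * d) (α : complexBetti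 (fiberOver f t) a) (β : complexBetti (fiberOver f t) b'), cupProduct hq (cupProduct (show a + 2 * q = a + 2 * q from rfl) (complexBetti.map (fst (fiberOver f t) (fiberOver f t)) a α) ζ) (complexBetti.map (snd (fiberOver f t) (fiberOver f t)) b' β) = cupProduct (show 2 * d + 2 * d = 4 * d by omega) (complexBetti.map (fst (fiberOver f t) (fiberOver f t)) (2 * d) ω) (complexBetti.map (snd (fiberOver f t) (fiberOver f t)) (2 * d) (cupProduct hb (T α) β)); let Flat := fun (a b : ℕ) (T : ∀ t : ComplexPoints U, complexBetti (fiberOver f t) a →ₗ[ℂ] complexBetti (fiberOver f t) b) => ∀ (s t : ComplexPoints U) (γ : Path s t) (α : complexBetti (fiberOver f s) a) (β : complexBetti (fiberOver f t) a), IsContinuationAlong γ α β → IsContinuationAlong γ (T s α) (T t β); AlgebraicGeometry.IsOpenImmersion j.left → Nonempty (ComplexPoints U) → IsSmoothProjectiveFamily f d → (∀ t, e t ∘ₗ e t = e t ∧ Alg k d k t (e t)) → Flat k k e → (∀ t, e' t ∘ₗ e' t = e' t ∧ Alg (k + 2 * c) d (k + 2 * c) t (e' t)) → Flat (k + 2 *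 c) (k + 2 * c) e' → Flat k (k + 2 * c) Φ → (∀ t x, IsRationalClass x → IsRationalClass (Φ t x)) → (∀ t (p q : ℕ), p + q = k → ∀ x, IsOfHodgeType d (fiberOver f t) k p q x → IsOfHodgeType d (fiberOver f t) (k + 2 * c) (p + c) (q + c) (Φ t x)) → (∀ t, Submodule.map (Φ t) (LinearMap.range (e t)) = LinearMap.range (e' t)) → (∀ M : (∀ t : ComplexPoints U, Submodule ℂ (complexBetti (fiberOver f t) k)), (∀ t, M t ≤ LinearMap.range (e t)) → (∀ (s t : ComplexPoints U) (γ : Path s t) (α : complexBetti (fiberOver f s) k) (β : complexBetti (fiberOver f t) k), α ∈ M s → IsContinuationAlong γ α β → β ∈ M t) → (∀ t, M t = ⊥) ∨ (∀ t, M t = LinearMap.range (e t))) → Nat.card {p : ComplexPoints (projectiveSpace 1 ℂ) // p ∉ Set.range (AlgPoints.map j)} = 3 → (∃ p : ComplexPoints (projectiveSpace 1 ℂ), p ∉ Set.range (AlgPoints.map j) ∧ ∃ O₀ ∈ nhds p, ∀ O ∈ nhds p, O ⊆ O₀ → IsOpen O → IsConnected O → ∀ t, Module.finrank ℂ (Submodule.span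 ℂ {σ : ∀ t : ComplexPoints U, complexBetti (fiberOver f t) k | (∀ t, σ t ∈ LinearMap.range (e t)) ∧ (∀ t, AlgPoints.map j t ∉ O → σ t = 0) ∧ ∀ (s t : ComplexPoints U) (γ : Path s t), (∀ x, AlgPoints.map j (γ x) ∈ O) → IsContinuationAlong γ (σ s) (σ t)}) + 1 = Module.finrank ℂ (LinearMap.range (e t))) → ∀ t, ∃ Ψ : complexBetti (fiberOver f t) k →ₗ[ℂ] complexBetti (fiberOver f t) (k + 2 * c), Alg k (d + c) (k + 2 * c) t Ψ ∧ Ψ ∘ₗ e t = Φ t ∘ₗ e t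

-- earlier HypergeometricReduction (stmt-HodgeConjecture-14769, replaced 2026-08-15T20:19:51Z -> stmt-HodgeConjecture-13731): retired by None — KummerEndgame → HypergeometricComparison
/-- item stmt-HodgeConjecture-13731 · crux · rank 5 · open · by planner
why it might fail: Content is r≥2, k≥2 (rank 1: finite monodromy, absorbed; r=2 in H¹ of curves: Lefschetz). Wind-back needs Katz inversion L_t(−1)→H^(k+2) of the Fermat-curve bundle w₁ᴹ+w₂ᴹ=t−s induced on H_! by the cylinder cycle of the M lines over s=t: Prym-type heuristic for M=2, open for M≥3; else a B-projector.
sources: BeukersHeckman1989, Katz1996, Katz2009, Dettweiler2008MC, DoranKostiuk2019, Andre1996Motifs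
[crux] KummerEndgame → HypergeometricComparison: the first rung of UnwindingReduction, for |S| = 3
and a pseudo-reflection at one puncture (Levelt / BeukersHeckman1989 Thm 3.5: L ⊗ ℂ is a sum of
hypergeometrics H(α;β), each reached from rank one by r − 1 middle convolutions by Kummer sheaves,
ranks 1,2,…,r; the tower is the classical Euler-integral tower yᴺ = ∏ xᵢ^aᵢ (1 − xᵢ)^bᵢ (t −
x₁⋯x_m)^c, Katz2009 §5). Flagship calibration: the rank-4 piece of H³ of the Dwork quintics versus
Katz's / CdlORV's curve realisations (known abstractly by coniveau, Chatzistamatiou2009 — a test of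
the METHOD, not a new theorem), then the symmetric K3 quartic pencils. [deps: KummerEndgame]
[difficulty: L] -/
@[route_item "route-HodgeConjecture-RigidUnwinding"]
def HypergeometricReduction : Prop :=
  KummerEndgame → (HypergeometricComparison)

-- item stmt-HodgeConjecture-13657 · crux (kind.auto-crux: conjecture-grade) · rank 9 · open · by planner — informal only, no Lean statement yet:
--   [support] ALGEBRAIC INVERSE (glue lemma used by the wind-back in UnwindingReduction and by the c < 0
--   direction of the sector): in the frame of RigidComparison with c = 0 and k = d (MIDDLE degree), if
--   Φ_t|L_t : L_t → L'_t is an isomorphism induced by an algebraic class (conclusion shape `Alg k d k t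
--   Ψ ∧ Ψ ∘ e_t = Φ_t ∘ e_t`) and L_t, L'_t have multiplicity one (Hom_flat(L, Hᵏ) = End_flat(L), a
--   division algebra D), then the inverse L'_t → L_t is also induced by an algebraic class: Ψ† :=
--   e^T-transpose of Ψ via middle-degree Poincaré duality (the diagonal; no Lefschetz operator) is
--   algebraic, Ψ†Ψ

-- item stmt-HodgeConjecture-13654 · support · rank 9 · open · by planner — informal only, no Lean statement yet:
--   [support] DELSARTE TOWER ENDGAME (card U2; the unconditionally closable face of KummerEndgame). For
--   inputs f = an invertible / generalized-Dwork pencil X_t : F_A(x) = t·∏xᵢ^{bᵢ} ⊂ Pⁿ⁺¹ (Katz2009 §1;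
--   DoranEtAl2018 §1.2, det A ≠ 0) and the Katz hypergeometric curve/Euler-integral families yᴺ =
--   ∏xᵢ^{aᵢ}(1−xᵢ)^{bᵢ}(t − x₁⋯x_m)^c, every level Y^{(j)} → U of the unwinding tower of
--   UnwindingReduction, after base change to the Fermat/Kummer curve T trivialising the bottom Kummer
--   characters, has total space birational to a DELSARTE COMPLETE INTERSECTION (the pencil parameter is
--   eliminated; each cyclic

-- item stmt-HodgeConjecture-13655 · support · rank 9 · open · by planner — informal only, no Lean statement yet:
--   [support] LEGENDRE INVERSION TEST (decides Kill (b) of the route; smallest instance of the split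
--   child InversionCycles of UnwindingReduction; everything is curves and rational/elliptic surfaces, so
--   Lefschetz (1,1) decides algebraicity). Let U = P¹∖{0,1,∞}, C : v² = s(s−1) → U the Kummer double
--   cover, L = the anti-invariant part of H⁰ of its fibres (rank one, monodromy −1 at 0 and 1). (a)
--   Y^{(1)}_t := {v² = s(s−1), w² = t − s} is a smooth affine model of the Legendre curve E_t and
--   (e_{−,−})·H¹_!(Y^{(1)}_t) = MC_{sign}(L)_t = H¹(E_t) (rank 2). (b) Y^{(2)}_t := {v² = s(s−1), w₁² +
--   w₂² = t − s, w₂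

-- item stmt-HodgeConjecture-13656 · support · rank 9 · open · by planner — informal only, no Lean statement yet:
--   [support] FLAGSHIP INSTANCE CENSUS: the rigid G₂-local systems of rank 7 on P¹∖{0,1,∞}.
--   Dettweiler–Reiter (DettweilerReiter2010, Compositio 146) construct them motivically by iterated
--   middle convolution of rank-one sheaves (a Katz tower by design); Yun2013 (Invent. 196, §1.2.1 and
--   the remark after Conj. 3.x) realises local systems with the same local monodromies in the cohomology
--   of a family of varieties coming from moduli of G-bundles / Kloosterman-type constructions and
--   expects coincidence with DR's 'by rigidity' (Katz1996 Thm 1.1.2: physically rigid). TASK: (1) record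
--   both realisations as i

/-- item stmt-HodgeConjecture-14770 · support · rank 9 · open · by planner
sources: Deligne2000
[support] (bookkeeping, NOT claimed) the complement of the route's sector: RigidComparison →
HodgeConjecture. It exists so that the deciding theorem concludes the sub-problem Statement by name
(declared sector route, D-0027 §2.1, same device as DerivedTorelliFermat.FourfoldSectorComplement /
HeckePrymWeil.SummitOffWeilSector); nobody is asked to prove it and graders should judge the route
on UnwindingReduction / KummerEndgame / HypergeometricReduction. Any route proving the summit
outright supersedes it. [difficulty: open-problem] -/
@[route_item "route-HodgeConjecture-RigidUnwinding", crux]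
def SectorComplement : Prop :=
  RigidComparison → _root_.HodgeConjecture

-- earlier Assembly (stmt-HodgeConjecture-14771, replaced 2026-08-15T21:20:55Z -> stmt-HodgeConjecture-13819): retired by None — UnwindingReduction → KummerEndgame → SectorComplement → _root_.HodgeConjecture
/-- item stmt-HodgeConjecture-13819 · assembly · rank 1 · open · by planner
sources: Katz1996, Deligne2000
[assembly] KummerEndgame → SectorComplement → HodgeConjecture, with the unwinding INLINED. RESTATED
2026-08-15 (route-repair, ground): the opening shape `UnwindingReduction → KummerEndgame →
SectorComplement → HodgeConjecture` was the deciding theorem `closes` re-curried — pure logic over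
the two glue items UnwindingReduction (:= KummerEndgame → RigidComparison) and SectorComplement (:=
RigidComparison → HodgeConjecture), hence ground.trivial by `tauto`. Proof content now = exactly the
content of the crux UnwindingReduction (Katz's algorithm run backwards on the family: KummerEndgame
⇒ RigidComparison, Katz1996 5.2.1 / Haraoka2020 Thm 7.24), followed by the declared, NOT-claimed
complement SectorComplement. Once UnwindingReduction is proved this closes in one line: `fun hK hC ↦
hC (unwindingReduction hK)` (repair planner's scratch: assembly_of_unwindingReduction, rc 0; the
restated shape has flags [] under #h21_ground, pos/neg/witness/vac batteries all run). Do not attack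
this item directly — work UnwindingReduction (rank 3) and its first rung HypergeometricReduction
(rank 5); the deciding theorem `closes (h₂ : UnwindingReduction) (h₃ : KummerEndgame) (hC :
SectorComplement)` is se -/
@[route_item "route-HodgeConjecture-RigidUnwinding"]
def Assembly : Prop :=
  KummerEndgame → SectorComplement → _root_.HodgeConjecture

/-! D-0027 §2.1 — DECIDING THEOREM (planner-authored via `route open/edit --closes-file`; by planner-plancard-HodgeConjecture-HodgeConject-6ed9cb67-g2-0 2026-08-15T19:12:01Z):
its hypotheses are this route's items and its conclusion the sub-problem Statement (glue_lint), and it elaborates with this file. -/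

@[closes "route-HodgeConjecture-RigidUnwinding"] theorem closes (h₂ : UnwindingReduction) (h₃ : KummerEndgame) (hC : SectorComplement) :
    _root_.HodgeConjecture :=
  hC (h₂ h₃)

end Summit.HodgeConjecture.HodgeConjecture.Theses.RigidUnwinding
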